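import Literature.NumberTheory.Sieve.MoebiusShiftedPrimesSmoothedRamare
import HarnessLib

/-!
# Möbius on shifted primes — the error terms of the smoothed decomposition and `E₁` repaired

Topic `Literature/NumberTheory/Sieve`, sequel to `MoebiusShiftedPrimesSmoothedRamare.lean` in the
decomposition of the named fact `Literature.NumberTheory.Sieve.Lichtman2020_majorArcEstimate`
(J. D. Lichtman, arXiv:2009.08969v2 [Lichtman2020], Proposition 3.2) at the PRINTED exponent
`P₁ = (log X)^{33A}`.  Everything in this file is PROVED; there are no named facts.

With the concrete ranges `N₁ = ⌈Y/2⌉`, `N₂ = ⌊4Y⌋` (`lowN`, `highN`) and the weight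
`γ_n = γ(log n)`, `γ` the Fejér-smoothed indicator of `[log Y + δ₀, log 2Y - δ₀]` at frequency `λ`
(`gam`, `FejerSmoothedIndicator.lean`), the identity of `decomposition'` reads
`G = (G - G_γ) + Main⁺ - D + E_sq` for `G(1+it) = ∑_{Y ≤ n ≤ 2Y} λχ𝟙_S(n) n^{-1-it}`.  This file bounds
the three error terms by the mean value theorem (Lemma 4.1, the tree's `meanvalue_subset` /
`pairs_meanvalue`) and assembles the bound on the good unit intervals:

* `abs_dCoeff_le`, `card_layer_le`, `meanvalue_diff_le` — the smoothing error `G - G_γ` has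
  coefficients `≤ 4/(m₀λδ₀)` off two layers of `≤ 8δ₀Y + 2` integers:
  `∫ |G - G_γ|² ≤ (5T+72Y)(4/Y²)(5Y(4/(m₀λδ₀))² + 8δ₀Y + 2)`;
* `coeff_Esq_le`, `meanvalue_Esq_le` — `E_sq` lives on `p² ∣ n`: `∫ |E_sq|² ≤ (5T+18N₂)(2N₂/P₁)/N₁²`;
* `wideWindow_prod_bounds`, `meanvalue_D_le` — the products of `D` lie outside `[N₁, N₂]`, at
  `log`-distance `≥ log 2` from the support of `γ`, where `γ ≤ 3/(m₀λ)`: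
  `∫ |D|² ≤ (5T+144Y)·96(3/(m₀λ))²/Y`;
* `lamChiOn_factor_all` (the factorisation `a(mp) = b(m)c(p)` for all `m`), `norm_sq_four_le`,
  `integral_four_le`, and the assembly `goodPart_le`: if every shift `t - u`, `|u| ≤ 2λ`, of every point
  of the unit intervals `n ∈ G` is good, then `∑_{n ∈ G} ∫_n^{n+1} |G|²` is at most four times the sum of
  the three mean values and the repaired `E₁` of `goodPart_mainPlus_le'` — NO factor `V²`.

The count of the (neighbourhood-enlarged) bad set and the asymptotic Proposition 5.1 at the printed
exponent are in `MoebiusShiftedPrimesDirichletMeanValue33.lean`.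

## References

* J. D. Lichtman, arXiv:2009.08969v2, §5.1 (Proposition 5.1, the bounds for `E₁`, `E₂`), pp. 14–15
  [Lichtman2020].
* K. Matomäki, M. Radziwiłł, Ann. of Math. (2) 183 (2016), Lemma 12 [MatomakiRadziwillAnnals2016].
-/

noncomputable section

open Finset Real Complex MeasureTheory Filter
open scoped Topology

namespace Literature.NumberTheory.Sieve.Lichtman2020.Smoothed

open MatomakiRadziwillLemma12 Literature.NumberTheory.LFunctions.FejerSmoothing

/-- The primes of `[P, Q]`. -/
local notation "Pr[" P ", " Q "]" => Finset.filter Nat.Prime (Finset.Icc ⌈(P : ℝ)⌉₊ ⌊(Q : ℝ)⌋₊)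
/-- `n^{-1-it}`. -/
local notation "cw[" t ", " n "]" => (((n : ℕ) : ℂ) ^ (-(1 + ((t : ℝ) : ℂ) * Complex.I)))
/-- The weight `1/(ω(m) + 1)`. -/
local notation "wt[" P ", " Q ", " m "]" => ((1 : ℂ) / ((primeDivisorsIn P Q m : ℂ) + 1))

/-! ### The concrete ranges and the smoothing weight -/

/-- `N₁ = ⌈Y/2⌉`, the lower end of the smoothed range. [folklore] -/
def lowN (Y : ℝ) : ℕ := ⌈Y / 2⌉₊

/-- `N₂ = ⌊4Y⌋`, the upper end of the smoothed range. [folklore] -/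
def highN (Y : ℝ) : ℕ := ⌊4 * Y⌋₊

/-- `b₁ = log Y + δ₀`. [folklore] -/
def bLo (Y δ₀ : ℝ) : ℝ := Real.log Y + δ₀

/-- `b₂ = log(2Y) - δ₀`. [folklore] -/
def bHi (Y δ₀ : ℝ) : ℝ := Real.log (2 * Y) - δ₀

/-- The smoothing weight `γ_n = γ(log n)`, `γ = 𝟙_{[b₁,b₂]} ∗ K_λ`. [folklore] -/
def gam (l Y δ₀ : ℝ) (n : ℕ) : ℝ := smoothIndicator l (bLo Y δ₀) (bHi Y δ₀) (Real.log n)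

/-- Basic inequalities for the ranges: `1 ≤ N₁`, `Y/2 ≤ N₁ < Y/2 + 1`, `4Y - 1 < N₂ ≤ 4Y` (`Y ≥ 2`). [folklore] -/
theorem range_facts {Y : ℝ} (hY : 2 ≤ Y) :
    1 ≤ lowN Y ∧ Y / 2 ≤ (lowN Y : ℝ) ∧ (lowN Y : ℝ) < Y / 2 + 1 ∧
      4 * Y - 1 < (highN Y : ℝ) ∧ (highN Y : ℝ) ≤ 4 * Y := by
  unfold lowN highN
  refine ⟨?_, Nat.le_ceil _, Nat.ceil_lt_add_one (by linarith), Nat.sub_one_lt_floor _,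
    Nat.floor_le (by linarith)⟩
  exact Nat.one_le_iff_ne_zero.mpr (Nat.ceil_pos.mpr (by linarith)).ne'

/-- `[⌈Y⌉, ⌊2Y⌋] ⊆ [N₁, N₂]` (`Y ≥ 0`). [folklore] -/
theorem Icc_subset_range {Y : ℝ} (hY : 0 ≤ Y) : Icc ⌈Y⌉₊ ⌊2 * Y⌋₊ ⊆ Icc (lowN Y) (highN Y) := by
  unfold lowN highN
  intro n hn
  rw [mem_Icc] at hn ⊢
  constructor
  · exact (Nat.ceil_mono (by linarith)).trans hn.1
  · exact hn.2.trans (Nat.floor_mono (by linarith))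

/-- `b₁ ≤ b₂` and `b₂ - b₁ ≤ 1` for `0 ≤ δ₀ ≤ 1/8`, `Y > 0`. [folklore] -/
theorem b_facts {Y δ₀ : ℝ} (hY : 0 < Y) (hδ₀ : 0 ≤ δ₀) (hδ₀' : δ₀ ≤ 1 / 8) :
    bLo Y δ₀ ≤ bHi Y δ₀ ∧ bHi Y δ₀ - bLo Y δ₀ ≤ 1 := by
  unfold bLo bHi
  rw [Real.log_mul (by norm_num) hY.ne']
  have h1 := Real.log_two_gt_d9
  have h2 := Real.log_two_lt_d9
  constructor <;> linarith

/-- `0 ≤ γ_n ≤ 1`. [folklore] -/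
theorem gam_mem {l Y δ₀ : ℝ} (hl : 0 < l) (hY : 0 < Y) (hδ₀ : 0 ≤ δ₀) (hδ₀' : δ₀ ≤ 1 / 8) (n : ℕ) :
    0 ≤ gam l Y δ₀ n ∧ gam l Y δ₀ n ≤ 1 :=
  ⟨smoothIndicator_nonneg hl.le (b_facts hY hδ₀ hδ₀').1 _, smoothIndicator_le_one hl (b_facts hY hδ₀ hδ₀').1 _⟩

/-! ### `G - G_γ`: the cost of smoothing the cut-offs -/

/-- The difference coefficient `d_n = 𝟙_{[Y,2Y]}(n) - γ_n`. [folklore] -/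
def dCoeff (l Y δ₀ : ℝ) (n : ℕ) : ℝ := (if n ∈ Icc ⌈Y⌉₊ ⌊2 * Y⌋₊ then 1 else 0) - gam l Y δ₀ n

/-- The transition layers `Y ≤ n < Y e^{2δ₀}` and `2Y e^{-2δ₀} < n ≤ 2Y`. [folklore] -/
def inLayer (Y δ₀ : ℝ) (n : ℕ) : Prop :=
  (Y ≤ n ∧ (n : ℝ) < Y * Real.exp (2 * δ₀)) ∨ (2 * Y * Real.exp (-(2 * δ₀)) < n ∧ (n : ℝ) ≤ 2 * Y)

/-- `inLayer Y δ₀` is decidable. [folklore] -/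
instance inLayer.decidablePred (Y δ₀ : ℝ) : DecidablePred (inLayer Y δ₀) := fun n => by
  unfold inLayer; infer_instance

/-- **The difference coefficients are small off the layers**: `|d_n| ≤ 1` always, and
`|d_n| ≤ 4/(m₀λδ₀)` unless `n` lies in a transition layer (`n ≥ 1`). [folklore] -/
theorem abs_dCoeff_le {l Y δ₀ : ℝ} (hl : 0 < l) (hY : 2 ≤ Y) (hδ₀ : 0 < δ₀) (hδ₀' : δ₀ ≤ 1 / 8)
    {n : ℕ} (hn : 1 ≤ n) :
    |dCoeff l Y δ₀ n| ≤ 1 ∧ (¬ inLayer Y δ₀ n → |dCoeff l Y δ₀ n| ≤ 4 / (fejerMass * l * δ₀)) := by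
  have hY0 : 0 < Y := by linarith
  obtain ⟨hb, _⟩ := b_facts hY0 hδ₀.le hδ₀'
  obtain ⟨hg0, hg1⟩ := gam_mem hl hY0 hδ₀.le hδ₀' n
  unfold gam at hg0 hg1
  have hm := fejerMass_pos
  have hη0 : 0 ≤ 4 / (fejerMass * l * δ₀) := by positivity
  have hn0 : (0 : ℝ) < n := by exact_mod_cast hn
  have hη : 2 / (fejerMass * l * δ₀) ≤ 4 / (fejerMass * l * δ₀) :=
    div_le_div_of_nonneg_right (by norm_num) (by positivity)
  unfold dCoeff gam
  constructor
  · split_ifs <;> rw [abs_le] <;> constructor <;> linarith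
  · intro hnl
    unfold inLayer at hnl
    push Not at hnl
    split_ifs with hmem
    · -- inside `[Y, 2Y]`, off the layers: `Y e^{2δ₀} ≤ n ≤ 2Y e^{-2δ₀}`
      rw [mem_Icc] at hmem
      have hYn : Y ≤ n := Nat.ceil_le.mp hmem.1
      have hn2Y : (n : ℝ) ≤ 2 * Y := (Nat.le_floor_iff (by linarith)).mp hmem.2
      have hlo : Y * Real.exp (2 * δ₀) ≤ n := hnl.1 hYn
      have hhi : (n : ℝ) ≤ 2 * Y * Real.exp (-(2 * δ₀)) := by
        by_contra h
        push Not at h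
        have := hnl.2 h
        linarith
      have h1 : bLo Y δ₀ + δ₀ ≤ Real.log n := by
        unfold bLo
        have := Real.log_le_log (by positivity) hlo
        rw [Real.log_mul hY0.ne' (Real.exp_pos _).ne', Real.log_exp] at this
        linarith
      have h2 : Real.log n + δ₀ ≤ bHi Y δ₀ := by
        unfold bHi
        have := Real.log_le_log hn0 hhi
        rw [Real.log_mul (by positivity) (Real.exp_pos _).ne', Real.log_exp] at this
        linarith
      have key := one_sub_smoothIndicator_le hl hδ₀ h1 h2
      rw [abs_le]; constructor <;> [linarith; linarith]
    · -- outside `[Y, 2Y]`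
      rw [mem_Icc, not_and_or, not_le, not_le] at hmem
      rw [zero_sub, abs_neg, abs_of_nonneg hg0]
      rcases hmem with h | h
      · -- `n < Y`
        have hnY : (n : ℝ) < Y := Nat.lt_ceil.mp h
        have h1 : Real.log n + δ₀ ≤ bLo Y δ₀ := by
          unfold bLo
          have := Real.log_le_log hn0 hnY.le
          linarith
        exact (smoothIndicator_le_of_le_left hl hδ₀ h1 hb).trans hη
      · -- `n > 2Y`
        have hnY : 2 * Y < n := (Nat.floor_lt (by linarith)).mp h
        have h1 : bHi Y δ₀ + δ₀ ≤ Real.log n := by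
          unfold bHi
          have := Real.log_le_log (by linarith) hnY.le
          linarith
        exact (smoothIndicator_le_of_ge_right hl hδ₀ h1 hb).trans hη

/-- `e^{x} - 1 ≤ 2x` for `0 ≤ x ≤ 1`, and `1 - e^{-x} ≤ x`. [folklore] -/
theorem exp_sub_one_le {x : ℝ} (hx0 : 0 ≤ x) (hx1 : x ≤ 1) :
    Real.exp x - 1 ≤ 2 * x ∧ 1 - Real.exp (-x) ≤ x := by
  constructor
  · have h := Real.abs_exp_sub_one_sub_id_le (by rw [abs_of_nonneg hx0]; exact hx1)
    have h2 : x ^ 2 ≤ x := by nlinarith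
    have h3 := (abs_le.mp h).2
    linarith
  · have := Real.add_one_le_exp (-x)
    linarith

/-- **The layers are thin**: `#{n ∈ [N₁,N₂] : n in a layer} ≤ 8δ₀Y + 2` (`0 < δ₀ ≤ 1/8`, `Y ≥ 2`). [folklore] -/
theorem card_layer_le {Y δ₀ : ℝ} (hY : 2 ≤ Y) (hδ₀ : 0 < δ₀) (hδ₀' : δ₀ ≤ 1 / 8) (s : Finset ℕ) :
    (#(s.filter (inLayer Y δ₀)) : ℝ) ≤ 8 * δ₀ * Y + 2 := by
  have hY0 : 0 < Y := by linarith
  obtain ⟨he1, he2⟩ := exp_sub_one_le (x := 2 * δ₀) (by linarith) (by linarith)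
  -- the two layers as integer windows
  have hsub : s.filter (inLayer Y δ₀) ⊆
      Ico ⌈Y⌉₊ ⌈Y * Real.exp (2 * δ₀)⌉₊ ∪ Ioc ⌊2 * Y * Real.exp (-(2 * δ₀))⌋₊ ⌊2 * Y⌋₊ := by
    intro n hn
    rw [mem_filter] at hn
    rw [mem_union, mem_Ico, mem_Ioc]
    rcases hn.2 with ⟨h1, h2⟩ | ⟨h1, h2⟩
    · left
      exact ⟨Nat.ceil_le.mpr h1, Nat.lt_ceil.mpr h2⟩
    · right
      exact ⟨(Nat.floor_lt (by positivity)).mpr h1, Nat.le_floor h2⟩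
  have h1 : (#(Ico ⌈Y⌉₊ ⌈Y * Real.exp (2 * δ₀)⌉₊) : ℝ) ≤ Y * Real.exp (2 * δ₀) - Y + 1 :=
    card_Ico_ceil_le hY0.le (by nlinarith [Real.add_one_le_exp (2 * δ₀)])
  have h2 : (#(Ioc ⌊2 * Y * Real.exp (-(2 * δ₀))⌋₊ ⌊2 * Y⌋₊) : ℝ) ≤ 2 * Y - 2 * Y * Real.exp (-(2 * δ₀)) + 1 := by
    refine card_Ioc_floor_le (by positivity) ?_
    have : Real.exp (-(2 * δ₀)) ≤ 1 := Real.exp_le_one_iff.mpr (by linarith)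
    nlinarith
  calc (#(s.filter (inLayer Y δ₀)) : ℝ)
      ≤ #(Ico ⌈Y⌉₊ ⌈Y * Real.exp (2 * δ₀)⌉₊ ∪ Ioc ⌊2 * Y * Real.exp (-(2 * δ₀))⌋₊ ⌊2 * Y⌋₊) := by
        exact_mod_cast card_le_card hsub
    _ ≤ #(Ico ⌈Y⌉₊ ⌈Y * Real.exp (2 * δ₀)⌉₊) + #(Ioc ⌊2 * Y * Real.exp (-(2 * δ₀))⌋₊ ⌊2 * Y⌋₊) := by
        exact_mod_cast card_union_le _ _
    _ ≤ (Y * Real.exp (2 * δ₀) - Y + 1) + (2 * Y - 2 * Y * Real.exp (-(2 * δ₀)) + 1) := add_le_add h1 h2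
    _ = Y * (Real.exp (2 * δ₀) - 1) + 2 * Y * (1 - Real.exp (-(2 * δ₀))) + 2 := by ring
    _ ≤ Y * (2 * (2 * δ₀)) + 2 * Y * (2 * δ₀) + 2 := by gcongr
    _ = 8 * δ₀ * Y + 2 := by ring

/-- **The long sum as a weighted sum over the smoothed range**:
`∑_{Y ≤ n ≤ 2Y} a_n n^{-s} - ∑_{N₁ ≤ n ≤ N₂} γ_n a_n n^{-s} = ∑_{N₁ ≤ n ≤ N₂} d_n a_n n^{-s}`. [folklore] -/
theorem diff_eq_sum_dCoeff {Y : ℝ} (hY : 0 ≤ Y) (l δ₀ : ℝ) (a : ℕ → ℂ) (t : ℝ) :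
    (∑ n ∈ Icc ⌈Y⌉₊ ⌊2 * Y⌋₊, a n * cw[t, n])
      - ∑ n ∈ Icc (lowN Y) (highN Y), (gam l Y δ₀ n : ℂ) * a n * cw[t, n] =
      ∑ n ∈ Icc (lowN Y) (highN Y), (dCoeff l Y δ₀ n : ℂ) * a n * cw[t, n] := by
  have hsub := Icc_subset_range hY
  have h1 : ∑ n ∈ Icc ⌈Y⌉₊ ⌊2 * Y⌋₊, a n * cw[t, n] =
      ∑ n ∈ Icc (lowN Y) (highN Y), (if n ∈ Icc ⌈Y⌉₊ ⌊2 * Y⌋₊ then (1 : ℂ) else 0) * a n * cw[t, n] := by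
    rw [← sum_subset hsub (fun n _ hn => by rw [if_neg hn, zero_mul, zero_mul])]
    exact sum_congr rfl fun n hn => by rw [if_pos hn, one_mul]
  rw [h1, ← sum_sub_distrib]
  refine sum_congr rfl fun n _ => ?_
  unfold dCoeff
  split_ifs <;> push_cast <;> ring

/-- **Mean value of `G - G_γ`**: for `‖a‖ ≤ 1`, `Y ≥ 2`, `0 < δ₀ ≤ 1/8`, `λ > 0`, `T > 0`,
`𝒯 ⊆ [-T, T]`:
`∫_𝒯 |∑_{N₁ ≤ n ≤ N₂} d_n a_n n^{-1-it}|² ≤ (5T + 72Y) · (4/Y²) · (5Y η₁² + 8δ₀Y + 2)`, `η₁ = 4/(m₀λδ₀)`.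
[cite: Lichtman2020, §5.1, proof of Proposition 5.1] -/
theorem meanvalue_diff_le {a : ℕ → ℂ} (ha : ∀ n, ‖a n‖ ≤ 1) {l Y δ₀ : ℝ} (hl : 0 < l) (hY : 2 ≤ Y)
    (hδ₀ : 0 < δ₀) (hδ₀' : δ₀ ≤ 1 / 8) {T : ℝ} (hT : 0 < T) {𝒯 : Set ℝ} (h𝒯 : 𝒯 ⊆ Set.Icc (-T) T) :
    ∫ t in 𝒯, ‖∑ n ∈ Icc (lowN Y) (highN Y), (dCoeff l Y δ₀ n : ℂ) * a n * cw[t, n]‖ ^ 2 ≤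
      (5 * T + 72 * Y) * (4 / Y ^ 2) *
        (5 * Y * (4 / (fejerMass * l * δ₀)) ^ 2 + 8 * δ₀ * Y + 2) := by
  obtain ⟨hN₁1, hN₁lo, hN₁hi, hN₂lo, hN₂hi⟩ := range_facts hY
  have hY0 : 0 < Y := by linarith
  set N₁ := lowN Y with hN₁
  set N₂ := highN Y with hN₂
  set η₁ := 4 / (fejerMass * l * δ₀) with hη₁
  have hη₁0 : 0 ≤ η₁ := by have := fejerMass_pos; positivity
  have hsub : Icc N₁ N₂ ⊆ Icc 1 N₂ := fun n hn => by rw [mem_Icc] at hn ⊢; omega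
  have h1 := meanvalue_subset (Icc N₁ N₂) N₂ hsub (fun n => (dCoeff l Y δ₀ n : ℂ) * a n) hT h𝒯
  refine h1.trans ?_
  have hfac : (5 * T + 18 * (N₂ : ℝ)) ≤ 5 * T + 72 * Y := by linarith
  -- termwise bound
  have hterm : ∀ n ∈ Icc N₁ N₂, ‖(dCoeff l Y δ₀ n : ℂ) * a n‖ ^ 2 / (n : ℝ) ^ 2 ≤
      (4 / Y ^ 2) * (η₁ ^ 2 + if inLayer Y δ₀ n then 1 else 0) := by
    intro n hn
    have hn1 : 1 ≤ n := (mem_Icc.1 (hsub hn)).1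
    have hnN₁ : (N₁ : ℝ) ≤ n := by exact_mod_cast (mem_Icc.1 hn).1
    have hn0 : (0 : ℝ) < n := by exact_mod_cast hn1
    obtain ⟨hd1, hd2⟩ := abs_dCoeff_le hl hY hδ₀ hδ₀' hn1
    have hnorm : ‖(dCoeff l Y δ₀ n : ℂ) * a n‖ ≤ |dCoeff l Y δ₀ n| := by
      rw [norm_mul, Complex.norm_real, Real.norm_eq_abs]
      calc |dCoeff l Y δ₀ n| * ‖a n‖ ≤ |dCoeff l Y δ₀ n| * 1 := by gcongr; exact ha n
        _ = _ := mul_one _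
    have hsq : ‖(dCoeff l Y δ₀ n : ℂ) * a n‖ ^ 2 ≤ η₁ ^ 2 + if inLayer Y δ₀ n then 1 else 0 := by
      have h0 := norm_nonneg ((dCoeff l Y δ₀ n : ℂ) * a n)
      split_ifs with hlay
      · have : ‖(dCoeff l Y δ₀ n : ℂ) * a n‖ ≤ 1 := hnorm.trans hd1
        nlinarith
      · have : ‖(dCoeff l Y δ₀ n : ℂ) * a n‖ ≤ η₁ := hnorm.trans (hd2 hlay)
        nlinarith
    have hinv : 1 / (n : ℝ) ^ 2 ≤ 4 / Y ^ 2 := by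
      rw [div_le_div_iff₀ (by positivity) (by positivity)]
      nlinarith
    calc ‖(dCoeff l Y δ₀ n : ℂ) * a n‖ ^ 2 / (n : ℝ) ^ 2
        = ‖(dCoeff l Y δ₀ n : ℂ) * a n‖ ^ 2 * (1 / (n : ℝ) ^ 2) := by ring
      _ ≤ (η₁ ^ 2 + if inLayer Y δ₀ n then 1 else 0) * (4 / Y ^ 2) :=
          mul_le_mul hsq hinv (by positivity) (by positivity)
      _ = _ := mul_comm _ _
  have hsum := sum_le_sum hterm
  rw [← mul_sum, sum_add_distrib, sum_const, nsmul_eq_mul, ← sum_filter, sum_const, nsmul_eq_mul,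
    mul_one, Nat.card_Icc] at hsum
  have hcard1 : ((N₂ + 1 - N₁ : ℕ) : ℝ) ≤ 5 * Y := by
    have : ((N₂ + 1 - N₁ : ℕ) : ℝ) ≤ (N₂ : ℝ) + 1 := by
      have h := Nat.sub_le (N₂ + 1) N₁
      exact_mod_cast h
    linarith
  have hcard2 := card_layer_le hY hδ₀ hδ₀' (Icc N₁ N₂)
  have hin : ((N₂ + 1 - N₁ : ℕ) : ℝ) * η₁ ^ 2 + #((Icc N₁ N₂).filter (inLayer Y δ₀)) ≤
      5 * Y * η₁ ^ 2 + 8 * δ₀ * Y + 2 := by nlinarith [sq_nonneg η₁]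
  have h0 : 0 ≤ ∑ n ∈ Icc N₁ N₂, ‖(dCoeff l Y δ₀ n : ℂ) * a n‖ ^ 2 / (n : ℝ) ^ 2 :=
    sum_nonneg fun n _ => by positivity
  calc (5 * T + 18 * (N₂ : ℝ)) * ∑ n ∈ Icc N₁ N₂, ‖(dCoeff l Y δ₀ n : ℂ) * a n‖ ^ 2 / (n : ℝ) ^ 2
      ≤ (5 * T + 72 * Y) * ((4 / Y ^ 2) * (5 * Y * η₁ ^ 2 + 8 * δ₀ * Y + 2)) := by
        refine mul_le_mul hfac (hsum.trans ?_) h0 (by positivity)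
        exact mul_le_mul_of_nonneg_left hin (by positivity)
    _ = _ := by ring

/-! ### `E_sq`: the pairs with `p² ∣ n` -/

/-- For `k ≥ 1`: `‖1/k - 1/(k+1)‖ ≤ 1/(k+1)` (complex). [folklore] -/
theorem norm_inv_sub_inv_le {k : ℕ} (hk : 1 ≤ k) :
    ‖(1 : ℂ) / (k : ℂ) - 1 / ((k : ℂ) + 1)‖ ≤ 1 / ((k : ℝ) + 1) := by
  have hk0 : (k : ℝ) ≠ 0 := by exact_mod_cast (show k ≠ 0 by omega)
  have hk1 : (0 : ℝ) < (k : ℝ) + 1 := by positivity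
  set r : ℝ := 1 / ((k : ℝ) * ((k : ℝ) + 1)) with hr
  have e : (1 : ℂ) / (k : ℂ) - 1 / ((k : ℂ) + 1) = (r : ℂ) := by
    have hk0' : (k : ℂ) ≠ 0 := by exact_mod_cast (show k ≠ 0 by omega)
    have hk1' : (k : ℂ) + 1 ≠ 0 := by exact_mod_cast hk1.ne'
    rw [hr]
    push_cast
    field_simp
    ring
  rw [e, Complex.norm_real, Real.norm_eq_abs, abs_of_nonneg (by positivity), hr]
  rw [div_le_div_iff₀ (by positivity) hk1]
  have : (1 : ℝ) ≤ k := by exact_mod_cast hk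
  nlinarith

/-- The coefficients of `E_sq`, `∑_{p ∣ n, p ∣ n/p, …} γ_n c_p b_{n/p} (1/ω(n/p) - 1/(ω(n/p)+1))`, are
bounded by `1` (`0 ≤ γ ≤ 1`, `‖b‖, ‖c‖ ≤ 1`, `sum_weights_le_one`). [folklore] -/
theorem coeff_Esq_le (P Q : ℝ) {b c : ℕ → ℂ} (hb : ∀ m, ‖b m‖ ≤ 1) (hc : ∀ p, ‖c p‖ ≤ 1)
    {γ : ℕ → ℝ} (hγ : ∀ n, 0 ≤ γ n ∧ γ n ≤ 1) (N₁ N₂ n : ℕ) :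
    ‖∑ p ∈ Pr[P, Q] with p ∣ n ∧ n / p ∈ (pairSet N₁ N₂ p).filter (fun m => p ∣ m),
        (γ (p * (n / p)) : ℂ) * (c p * b (n / p) *
          (1 / (primeDivisorsIn P Q (n / p) : ℂ) - 1 / ((primeDivisorsIn P Q (n / p) : ℂ) + 1)))‖ ≤ 1 := by
  have hPr : ∀ p ∈ Pr[P, Q], p.Prime := fun p hp => (mem_filter.1 hp).2
  set F := (Pr[P, Q]).filter (fun p => p ∣ n ∧ n / p ∈ (pairSet N₁ N₂ p).filter (fun m => p ∣ m)) with hF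
  have hω : ∀ p ∈ F, 1 ≤ primeDivisorsIn P Q (n / p) := by
    intro p hp
    rw [hF] at hp
    have hpP : p ∈ Pr[P, Q] := (mem_filter.1 hp).1
    have hpm : p ∣ n / p := (mem_filter.1 (mem_filter.1 hp).2.2).2
    rw [primeDivisorsIn_eq, Nat.one_le_iff_ne_zero, ← pos_iff_ne_zero, card_pos]
    exact ⟨p, mem_filter.2 ⟨hpP, hpm⟩⟩
  calc ‖∑ p ∈ F, (γ (p * (n / p)) : ℂ) * (c p * b (n / p) *
          (1 / (primeDivisorsIn P Q (n / p) : ℂ) - 1 / ((primeDivisorsIn P Q (n / p) : ℂ) + 1)))‖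
      ≤ ∑ p ∈ F, ‖(γ (p * (n / p)) : ℂ) * (c p * b (n / p) *
          (1 / (primeDivisorsIn P Q (n / p) : ℂ) - 1 / ((primeDivisorsIn P Q (n / p) : ℂ) + 1)))‖ :=
        norm_sum_le _ _
    _ ≤ ∑ p ∈ F, 1 / ((primeDivisorsIn P Q (n / p) : ℝ) + 1) := by
        refine sum_le_sum fun p hp => ?_
        rw [norm_mul, norm_mul, norm_mul, Complex.norm_real, Real.norm_eq_abs,
          abs_of_nonneg (hγ _).1]
        have h1 := (hγ (p * (n / p))).2
        have h2 := hc p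
        have h3 := hb (n / p)
        have h4 := norm_inv_sub_inv_le (hω p hp)
        have h5 : 0 ≤ 1 / ((primeDivisorsIn P Q (n / p) : ℝ) + 1) := by positivity
        calc γ (p * (n / p)) * (‖c p‖ * ‖b (n / p)‖ *
              ‖(1 : ℂ) / (primeDivisorsIn P Q (n / p) : ℂ) - 1 / ((primeDivisorsIn P Q (n / p) : ℂ) + 1)‖)
            ≤ 1 * (1 * 1 * (1 / ((primeDivisorsIn P Q (n / p) : ℝ) + 1))) := by
              gcongr
          _ = _ := by ring
    _ ≤ ∑ p ∈ Pr[P, Q] with p ∣ n, 1 / ((primeDivisorsIn P Q (n / p) : ℝ) + 1) := by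
        refine sum_le_sum_of_subset_of_nonneg (fun p hp => ?_) fun _ _ _ => by positivity
        rw [hF, mem_filter] at hp
        rw [mem_filter]
        exact ⟨hp.1, hp.2.1⟩
    _ ≤ 1 := by
        simp_rw [primeDivisorsIn_eq]
        exact sum_weights_le_one _ hPr n

/-- **Mean value of `E_sq`**: with `1 ≤ P ≤ Q`, `N₁ ≥ 1`, `‖b‖, ‖c‖ ≤ 1`, `0 ≤ γ ≤ 1`, `T > 0`, `𝒯 ⊆ [-T, T]`:
`∫_𝒯 |E_sq|² ≤ (5T + 18N₂) (2N₂/P)/N₁²` (the support has `p² ∣ n` for some prime `p ≥ P`).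
[cite: Lichtman2020, §5.1, proof of Proposition 5.1] -/
theorem meanvalue_Esq_le {P Q : ℝ} (hP : 1 ≤ P) {N₁ N₂ : ℕ} (hN₁ : 1 ≤ N₁)
    {b c : ℕ → ℂ} (hb : ∀ m, ‖b m‖ ≤ 1) (hc : ∀ p, ‖c p‖ ≤ 1) {γ : ℕ → ℝ} (hγ : ∀ n, 0 ≤ γ n ∧ γ n ≤ 1)
    {T : ℝ} (hT : 0 < T) {𝒯 : Set ℝ} (h𝒯 : 𝒯 ⊆ Set.Icc (-T) T) :
    ∫ t in 𝒯, ‖∑ p ∈ Pr[P, Q], ∑ m ∈ (pairSet N₁ N₂ p).filter (fun m => p ∣ m),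
        (γ (p * m) : ℂ) * (c p * b m *
          (1 / (primeDivisorsIn P Q m : ℂ) - 1 / ((primeDivisorsIn P Q m : ℂ) + 1))) * cw[t, p * m]‖ ^ 2 ≤
      (5 * T + 18 * N₂) * (2 * N₂ / P) / (N₁ : ℝ) ^ 2 := by
  classical
  have hPs : ∀ p ∈ Pr[P, Q], 0 < p := fun p hp => (mem_filter.1 hp).2.pos
  have hN₁0 : (0 : ℝ) < N₁ := by exact_mod_cast hN₁
  set S : ℕ → Finset ℕ := fun p => (pairSet N₁ N₂ p).filter (fun m => p ∣ m) with hS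
  have hSm : ∀ p ∈ Pr[P, Q], ∀ m ∈ S p, 1 ≤ m ∧ p * m ≤ N₂ := by
    intro p _ m hm
    rw [hS, mem_filter, mem_pairSet] at hm
    exact ⟨hm.1.1.1, hm.1.2.2⟩
  set cond : ℕ → Prop := fun n => N₁ ≤ n ∧ ∃ q ∈ Pr[P, Q], q ^ 2 ∣ n with hcond
  have hsupp : ∀ n ∈ Icc 1 N₂, ∀ p ∈ Pr[P, Q], p ∣ n → n / p ∈ S p → cond n := by
    intro n _ p hp hpn hm
    rw [hS, mem_filter, mem_pairSet, Nat.mul_div_cancel' hpn] at hm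
    refine ⟨hm.1.2.1, p, hp, ?_⟩
    have := Nat.mul_dvd_mul_left p hm.2
    rwa [Nat.mul_div_cancel' hpn, ← sq] at this
  have hB := coeff_sq_le_indicator (Pr[P, Q]) S
    (fun p m => (γ (p * m) : ℂ) * (c p * b m *
      (1 / (primeDivisorsIn P Q m : ℂ) - 1 / ((primeDivisorsIn P Q m : ℂ) + 1)))) N₂ cond
    (fun n _ => coeff_Esq_le P Q hb hc hγ N₁ N₂ n) hsupp
  have key := pairs_meanvalue (Pr[P, Q]) hPs S N₂ hSm
    (fun p m => (γ (p * m) : ℂ) * (c p * b m *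
      (1 / (primeDivisorsIn P Q m : ℂ) - 1 / ((primeDivisorsIn P Q m : ℂ) + 1)))) hT h𝒯 _ hB
  refine key.trans ?_
  rw [mul_div_assoc]
  refine mul_le_mul_of_nonneg_left ?_ (by positivity)
  refine (sum_indicator_div_sq_le N₂ cond hN₁0 fun n _ h => by
    obtain ⟨h1, -⟩ := h; exact_mod_cast h1).trans ?_
  refine div_le_div_of_nonneg_right ?_ (by positivity)
  -- the count of `n ≤ N₂` with `p² ∣ n`
  calc (#((Icc 1 N₂).filter cond) : ℝ) ≤ #((Icc 1 N₂).filter (fun n => ∃ q ∈ Pr[P, Q], q ^ 2 ∣ n)) := by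
        refine Nat.cast_le.mpr (card_le_card fun n hn => ?_)
        rw [mem_filter] at hn ⊢
        exact ⟨hn.1, hn.2.2⟩
    _ ≤ ∑ q ∈ Pr[P, Q], (N₂ : ℝ) / (q : ℝ) ^ 2 := card_filter_exists_sq_dvd_le _ _
    _ ≤ ∑ q ∈ Icc ⌈P⌉₊ ⌊Q⌋₊, (N₂ : ℝ) / (q : ℝ) ^ 2 :=
        sum_le_sum_of_subset_of_nonneg (filter_subset _ _) fun _ _ _ => by positivity
    _ = N₂ * ∑ q ∈ Icc ⌈P⌉₊ ⌊Q⌋₊, ((q : ℝ) ^ 2)⁻¹ := by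
        rw [mul_sum]; exact sum_congr rfl fun q _ => by rw [div_eq_mul_inv]
    _ ≤ N₂ * (2 / P) := mul_le_mul_of_nonneg_left (sum_Icc_inv_sq_le hP) (Nat.cast_nonneg _)
    _ = 2 * N₂ / P := by ring

/-! ### `D`: the pairs of the wide windows that fall outside `[N₁, N₂]` -/

/-- Members of a wide window lie in `[1, N₂]` (`N₁ ≥ 1`, `V > 0`). [folklore] -/
theorem wideWindow_subset {N₁ N₂ : ℕ} (hN₁ : 1 ≤ N₁) {V : ℝ} (hV : 0 < V) (v : ℕ) :
    wideWindow N₁ N₂ V v ⊆ Icc 1 N₂ := by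
  intro m hm
  unfold wideWindow at hm
  rw [mem_Icc] at hm ⊢
  have hN₁0 : (0 : ℝ) < N₁ := by exact_mod_cast hN₁
  constructor
  · exact (Nat.one_le_iff_ne_zero.2 (Nat.ceil_pos.2 (mul_pos hN₁0 (Real.exp_pos _))).ne').trans hm.1
  · refine hm.2.trans (Nat.floor_le_of_le ?_)
    have h1 : Real.exp (-((v : ℝ) / V)) ≤ 1 := Real.exp_le_one_iff.mpr (by
      have : 0 ≤ (v : ℝ) / V := by positivity
      linarith)
    calc (N₂ : ℝ) * Real.exp (-((v : ℝ) / V)) ≤ N₂ * 1 := by gcongr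
      _ = N₂ := mul_one _

/-- **The products of the wide windows**: for a prime `p` in the block `v(p) = ⌊V log p⌋` and
`m ∈ M_{v(p)}`, `N₁ e^{-1/V} ≤ pm < e^{1/V} N₂ ≤ 2N₂` (`V ≥ 2`). [folklore] -/
theorem wideWindow_prod_bounds {N₁ N₂ : ℕ} (hN₁ : 1 ≤ N₁) {V : ℝ} (hV : 2 ≤ V) {p : ℕ} (hp : 1 ≤ p)
    {m : ℕ} (hm : m ∈ wideWindow N₁ N₂ V ⌊V * Real.log p⌋₊) :
    (N₁ : ℝ) * Real.exp (-(1 / V)) ≤ (p * m : ℕ) ∧ ((p * m : ℕ) : ℝ) < Real.exp (1 / V) * N₂ ∧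
      p * m ≤ 2 * N₂ := by
  have hV0 : 0 < V := by linarith
  obtain ⟨hb1, hb2⟩ := (block_iff hV0 hp _).2 rfl
  set v := ⌊V * Real.log p⌋₊ with hv
  unfold wideWindow at hm
  rw [mem_Icc] at hm
  have hp0 : (0 : ℝ) < p := by exact_mod_cast hp
  have hmlo : (N₁ : ℝ) * Real.exp (-(((v : ℝ) + 1) / V)) ≤ m := Nat.ceil_le.1 hm.1
  have hmhi : (m : ℝ) ≤ (N₂ : ℝ) * Real.exp (-((v : ℝ) / V)) := (Nat.le_floor_iff (by positivity)).1 hm.2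
  have e1 : Real.exp ((v : ℝ) / V) * Real.exp (-(((v : ℝ) + 1) / V)) = Real.exp (-(1 / V)) := by
    rw [← Real.exp_add]; congr 1; field_simp; ring
  have e2 : Real.exp (((v : ℝ) + 1) / V) * Real.exp (-((v : ℝ) / V)) = Real.exp (1 / V) := by
    rw [← Real.exp_add]; congr 1; field_simp; ring
  have hlo : (N₁ : ℝ) * Real.exp (-(1 / V)) ≤ (p * m : ℕ) := by
    push_cast
    calc (N₁ : ℝ) * Real.exp (-(1 / V)) = Real.exp ((v : ℝ) / V) * ((N₁ : ℝ) * Real.exp (-(((v : ℝ) + 1) / V))) := by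
          rw [← e1]; ring
      _ ≤ p * m := mul_le_mul hb1 hmlo (by positivity) hp0.le
  have hhi : ((p * m : ℕ) : ℝ) < Real.exp (1 / V) * N₂ := by
    push_cast
    have hm0 : (0 : ℝ) ≤ m := Nat.cast_nonneg m
    rcases hm0.eq_or_lt with h0 | h0
    · rw [← h0, mul_zero]
      have hN₂ : (0 : ℝ) ≤ N₂ := Nat.cast_nonneg _
      rcases hN₂.eq_or_lt with h | h
      · -- `N₂ = 0` forces the window to be empty above; then `m = 0 < ...` needs care
        rw [← h] at hmhi
        simp only [zero_mul] at hmhi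
        have : (m : ℝ) = 0 := h0.symm
        rw [← h, mul_zero]
        -- `0 < 0` is false: but then `m ≤ 0` and `m ≥ ⌈N₁ e^{..}⌉ ≥ 1`, contradiction
        exfalso
        have h1 : 1 ≤ m := (Nat.one_le_iff_ne_zero.2 (Nat.ceil_pos.2
          (mul_pos (by exact_mod_cast hN₁ : (0:ℝ) < N₁) (Real.exp_pos _))).ne').trans hm.1
        have : (1 : ℝ) ≤ m := by exact_mod_cast h1
        linarith
      · positivity
    calc (p : ℝ) * m < Real.exp (((v : ℝ) + 1) / V) * m := mul_lt_mul_of_pos_right hb2 h0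
      _ ≤ Real.exp (((v : ℝ) + 1) / V) * ((N₂ : ℝ) * Real.exp (-((v : ℝ) / V))) :=
          mul_le_mul_of_nonneg_left hmhi (Real.exp_pos _).le
      _ = Real.exp (1 / V) * N₂ := by rw [← e2]; ring
  refine ⟨hlo, hhi, ?_⟩
  have he : Real.exp (1 / V) ≤ 2 := by
    have h1 : Real.exp (1 / V) ≤ Real.exp (1 / 2) := Real.exp_le_exp.2 (by
      rw [div_le_div_iff₀ (by linarith) (by norm_num)]; linarith)
    have h2 : Real.exp (1 / 2 : ℝ) ≤ 2 := by
      have h3 : Real.exp (1 / 2 : ℝ) ^ 2 = Real.exp 1 := by rw [← Real.exp_nat_mul]; norm_num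
      nlinarith [Real.exp_one_lt_d9, Real.exp_pos (1 / 2 : ℝ)]
    linarith
  have : ((p * m : ℕ) : ℝ) ≤ 2 * N₂ := by
    have hN₂ : (0 : ℝ) ≤ N₂ := Nat.cast_nonneg _
    nlinarith
  exact_mod_cast this

/-- **Mean value of `D`** (for the concrete ranges `N₁ = ⌈Y/2⌉`, `N₂ = ⌊4Y⌋` and the weight `γ = gam`):
with `1 ≤ P ≤ Q`, `V ≥ 2`, `‖b‖, ‖c‖ ≤ 1`, `Y ≥ 2`, `0 < δ₀ ≤ 1/8`, `λ > 0`, `T > 0`, `𝒯 ⊆ [-T, T]`: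
`∫_𝒯 |D|² ≤ (5T + 144Y) · 96 η'²/Y`, `η' = 3/(m₀λ)` — the products `pm` of `D` lie outside `[N₁, N₂]`,
at distance `≥ log 2` (in `log`) from `[b₁, b₂]`, where `γ ≤ 2/(m₀ λ log 2) ≤ η'`.
[cite: Lichtman2020, §5.1, proof of Proposition 5.1] -/
theorem meanvalue_D_le {P Q V : ℝ} (hP : 1 ≤ P) (hPQ : P ≤ Q) (hV : 2 ≤ V)
    {b c : ℕ → ℂ} (hb : ∀ m, ‖b m‖ ≤ 1) (hc : ∀ p, ‖c p‖ ≤ 1) {l Y δ₀ : ℝ} (hl : 0 < l) (hY : 2 ≤ Y)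
    (hδ₀ : 0 < δ₀) (hδ₀' : δ₀ ≤ 1 / 8) {T : ℝ} (hT : 0 < T) {𝒯 : Set ℝ} (h𝒯 : 𝒯 ⊆ Set.Icc (-T) T) :
    ∫ t in 𝒯, ‖∑ p ∈ Pr[P, Q], ∑ m ∈ wideWindow (lowN Y) (highN Y) V ⌊V * Real.log p⌋₊ \ pairSet (lowN Y) (highN Y) p,
        (gam l Y δ₀ (p * m) : ℂ) * (c p * b m * wt[P, Q, m]) * cw[t, p * m]‖ ^ 2 ≤
      (5 * T + 144 * Y) * (96 * (3 / (fejerMass * l)) ^ 2 / Y) := by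
  classical
  obtain ⟨hN₁1, hN₁lo, hN₁hi, hN₂lo, hN₂hi⟩ := range_facts hY
  have hY0 : 0 < Y := by linarith
  have hV0 : 0 < V := by linarith
  have hQ0 : 0 ≤ Q := by linarith
  obtain ⟨hbb, _⟩ := b_facts hY0 hδ₀.le hδ₀'
  have hm0 := fejerMass_pos
  set N₁ := lowN Y with hN₁
  set N₂ := highN Y with hN₂
  set η' := 3 / (fejerMass * l) with hη'
  have hη'0 : 0 ≤ η' := by positivity
  have hPs : ∀ p ∈ Pr[P, Q], 0 < p := fun p hp => (mem_filter.1 hp).2.pos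
  have hN₁0 : (0 : ℝ) < N₁ := by exact_mod_cast hN₁1
  set S : ℕ → Finset ℕ := fun p => wideWindow N₁ N₂ V ⌊V * Real.log p⌋₊ \ pairSet N₁ N₂ p with hS
  have hSm : ∀ p ∈ Pr[P, Q], ∀ m ∈ S p, 1 ≤ m ∧ p * m ≤ 2 * N₂ := by
    intro p hp m hm
    simp only [hS, Finset.mem_sdiff] at hm
    have hp1 : 1 ≤ p := ((mem_Pr hQ0).1 hp).1.one_lt.le
    exact ⟨(mem_Icc.1 (wideWindow_subset hN₁1 hV0 _ hm.1)).1, (wideWindow_prod_bounds hN₁1 hV hp1 hm.1).2.2⟩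
  -- the support condition and its consequences
  set cond : ℕ → Prop := fun n => ∃ p ∈ Pr[P, Q], p ∣ n ∧ n / p ∈ S p with hcond
  have hcondfacts : ∀ n, cond n → (N₁ : ℝ) * Real.exp (-(1 / V)) ≤ n ∧ gam l Y δ₀ n ≤ η' := by
    rintro n ⟨p, hp, hpn, hm⟩
    have hp1 : 1 ≤ p := ((mem_Pr hQ0).1 hp).1.one_lt.le
    simp only [hS, Finset.mem_sdiff] at hm
    obtain ⟨hmw, hmA⟩ := hm
    obtain ⟨hlo, -, -⟩ := wideWindow_prod_bounds hN₁1 hV hp1 hmw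
    rw [Nat.mul_div_cancel' hpn] at hlo
    refine ⟨hlo, ?_⟩
    -- `n ∉ [N₁, N₂]`
    have hmI := wideWindow_subset hN₁1 hV0 _ hmw
    have hnot : ¬ (N₁ ≤ n ∧ n ≤ N₂) := by
      intro h
      apply hmA
      rw [mem_pairSet, Nat.mul_div_cancel' hpn]
      exact ⟨mem_Icc.1 hmI, h⟩
    have hn0 : (0 : ℝ) < n := lt_of_lt_of_le (mul_pos hN₁0 (Real.exp_pos _)) hlo
    have hlog2 := Real.log_two_gt_d9
    have hγle : gam l Y δ₀ n ≤ 2 / (fejerMass * l * Real.log 2) := by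
      unfold gam
      rw [not_and_or, not_le, not_le] at hnot
      rcases hnot with h | h
      · -- `n < N₁ = ⌈Y/2⌉`: `n < Y/2`
        have hnY : (n : ℝ) < Y / 2 := by
          have : n < ⌈Y / 2⌉₊ := h
          exact Nat.lt_ceil.1 this
        refine smoothIndicator_le_of_le_left hl (by linarith) ?_ hbb
        unfold bLo
        have h1 : Real.log n + Real.log 2 ≤ Real.log Y := by
          rw [← Real.log_mul hn0.ne' (by norm_num)]
          exact Real.log_le_log (by positivity) (by linarith)
        linarith
      · -- `n > N₂ = ⌊4Y⌋`: `n > 4Y`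
        have hnY : 4 * Y < n := by
          have : ⌊4 * Y⌋₊ < n := h
          exact (Nat.floor_lt (by linarith)).1 this
        refine smoothIndicator_le_of_ge_right hl (by linarith) ?_ hbb
        unfold bHi
        have h1 : Real.log (2 * Y) + Real.log 2 ≤ Real.log n := by
          rw [← Real.log_mul (by positivity) (by norm_num)]
          exact Real.log_le_log (by positivity) (by linarith)
        linarith
    refine hγle.trans ?_
    rw [hη', div_le_div_iff₀ (by positivity) (by positivity)]
    nlinarith [mul_pos hm0 hl]
  -- the coefficient bound
  have hB : ∀ n ∈ Icc 1 (2 * N₂), ‖∑ p ∈ Pr[P, Q] with p ∣ n ∧ n / p ∈ S p,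
      (gam l Y δ₀ (p * (n / p)) : ℂ) * (c p * b (n / p) * wt[P, Q, n / p])‖ ^ 2 ≤
      if cond n then η' ^ 2 else 0 := by
    intro n _
    by_cases h : ((Pr[P, Q]).filter (fun p => p ∣ n ∧ n / p ∈ S p)).Nonempty
    · obtain ⟨p, hp⟩ := h
      rw [mem_filter] at hp
      have hc' : cond n := ⟨p, hp.1, hp.2.1, hp.2.2⟩
      rw [if_pos hc']
      obtain ⟨-, hγ⟩ := hcondfacts n hc'
      have hγ0 : 0 ≤ gam l Y δ₀ n := (gam_mem hl hY0 hδ₀.le hδ₀' n).1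
      have hfactor : ∑ p ∈ Pr[P, Q] with p ∣ n ∧ n / p ∈ S p,
          (gam l Y δ₀ (p * (n / p)) : ℂ) * (c p * b (n / p) * wt[P, Q, n / p]) =
          (gam l Y δ₀ n : ℂ) * ∑ p ∈ Pr[P, Q] with p ∣ n ∧ n / p ∈ S p, c p * b (n / p) * wt[P, Q, n / p] := by
        rw [mul_sum]
        refine sum_congr rfl fun p hp => ?_
        rw [Nat.mul_div_cancel' (mem_filter.1 hp).2.1]
      rw [hfactor, norm_mul, Complex.norm_real, Real.norm_eq_abs, abs_of_nonneg hγ0]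
      have h1 := coeff_wt_le P Q hb hc S n
      have : gam l Y δ₀ n * ‖∑ p ∈ Pr[P, Q] with p ∣ n ∧ n / p ∈ S p, c p * b (n / p) * wt[P, Q, n / p]‖ ≤ η' :=
        calc _ ≤ η' * 1 := mul_le_mul hγ h1 (norm_nonneg _) hη'0
          _ = η' := mul_one _
      have h0 : 0 ≤ gam l Y δ₀ n * ‖∑ p ∈ Pr[P, Q] with p ∣ n ∧ n / p ∈ S p, c p * b (n / p) * wt[P, Q, n / p]‖ := by
        positivity
      nlinarith
    · rw [not_nonempty_iff_eq_empty.1 h, sum_empty, norm_zero, zero_pow two_ne_zero]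
      split_ifs <;> positivity
  have key := pairs_meanvalue (Pr[P, Q]) hPs S (2 * N₂) hSm
    (fun p m => (gam l Y δ₀ (p * m) : ℂ) * (c p * b m * wt[P, Q, m])) hT h𝒯 _ hB
  refine key.trans ?_
  -- `∑ B/n² ≤ η'² #/L²`
  have hL0 : 0 < (N₁ : ℝ) * Real.exp (-(1 / V)) := mul_pos hN₁0 (Real.exp_pos _)
  have hsumB : ∑ n ∈ Icc 1 (2 * N₂), (if cond n then η' ^ 2 else 0) / (n : ℝ) ^ 2 ≤
      η' ^ 2 * (2 * (N₂ : ℝ)) / ((N₁ : ℝ) * Real.exp (-(1 / V))) ^ 2 := by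
    have h1 : ∑ n ∈ Icc 1 (2 * N₂), (if cond n then η' ^ 2 else 0) / (n : ℝ) ^ 2 =
        η' ^ 2 * ∑ n ∈ Icc 1 (2 * N₂), (if cond n then (1 : ℝ) else 0) / (n : ℝ) ^ 2 := by
      rw [mul_sum]
      refine sum_congr rfl fun n _ => ?_
      split_ifs <;> ring
    rw [h1, mul_div_assoc]
    refine mul_le_mul_of_nonneg_left ?_ (sq_nonneg _)
    refine (sum_indicator_div_sq_le (2 * N₂) cond hL0 fun n _ h => (hcondfacts n h).1).trans ?_
    refine div_le_div_of_nonneg_right ?_ (by positivity)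
    have := card_filter_le (Icc 1 (2 * N₂)) cond
    rw [Nat.card_Icc] at this
    have : ((#((Icc 1 (2 * N₂)).filter cond) : ℕ) : ℝ) ≤ ((2 * N₂ + 1 - 1 : ℕ) : ℝ) := by exact_mod_cast this
    simpa using this
  have hpre : (0 : ℝ) ≤ 5 * T + 18 * ((2 * N₂ : ℕ) : ℝ) := by positivity
  refine (mul_le_mul_of_nonneg_left hsumB hpre).trans ?_
  -- numerics: `N₂ ≤ 4Y`, `N₁ ≥ Y/2`, `e^{2/V} ≤ 3`
  have he : Real.exp (-(1 / V)) ^ 2 ≥ 1 / 3 := by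
    have h1 : Real.exp (-(1 / V)) ^ 2 = Real.exp (-(2 / V)) := by
      rw [← Real.exp_nat_mul]; congr 1; push_cast; ring
    rw [h1, ge_iff_le]
    have h2 : Real.exp (-1) ≤ Real.exp (-(2 / V)) := Real.exp_le_exp.2 (by
      rw [neg_le_neg_iff, div_le_iff₀ (by linarith)]; linarith)
    have h3 : (1 : ℝ) / 3 ≤ Real.exp (-1) := by
      rw [Real.exp_neg, one_div, inv_le_inv₀ (by norm_num) (Real.exp_pos 1)]
      have := Real.exp_one_lt_d9; linarith
    linarith
  have hN₂' : 2 * (N₂ : ℝ) ≤ 8 * Y := by linarith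
  have hcast : ((2 * N₂ : ℕ) : ℝ) = 2 * (N₂ : ℝ) := by push_cast; ring
  have hden : Y ^ 2 / 12 ≤ ((N₁ : ℝ) * Real.exp (-(1 / V))) ^ 2 := by
    rw [mul_pow]
    have h1 : Y ^ 2 / 4 ≤ (N₁ : ℝ) ^ 2 := by nlinarith
    nlinarith [sq_nonneg (N₁ : ℝ)]
  have hfrac : η' ^ 2 * (2 * (N₂ : ℝ)) / ((N₁ : ℝ) * Real.exp (-(1 / V))) ^ 2 ≤ 96 * η' ^ 2 / Y := by
    rw [div_le_div_iff₀ (by positivity) hY0]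
    have h0 : 0 ≤ η' ^ 2 := sq_nonneg _
    calc η' ^ 2 * (2 * (N₂ : ℝ)) * Y ≤ η' ^ 2 * (8 * Y) * Y := by gcongr
      _ = 96 * η' ^ 2 * (Y ^ 2 / 12) := by ring
      _ ≤ 96 * η' ^ 2 * ((N₁ : ℝ) * Real.exp (-(1 / V))) ^ 2 := by gcongr
  calc (5 * T + 18 * ((2 * N₂ : ℕ) : ℝ)) * (η' ^ 2 * (2 * (N₂ : ℝ)) / ((N₁ : ℝ) * Real.exp (-(1 / V))) ^ 2)
      ≤ (5 * T + 144 * Y) * (96 * η' ^ 2 / Y) := by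
        refine mul_le_mul (by rw [hcast]; linarith) hfrac (by positivity) (by positivity)

/-! ### Assembly on the good unit intervals -/

/-- **The factorisation `a(mp) = b(m) c(p)` for ALL `m`** (not only `p ∤ m`): for `a = λχ𝟙_S`,
`S = {HasPF[P,Q] ∧ HasPF[P',Q']}`, `[P,Q] ∩ [P',Q'] = ∅`, `b = λχ𝟙_{HasPF[P',Q']}`, `c = λχ` and a prime
`p ∈ [P, Q]` (complete multiplicativity of `λχ`; `m = 0` gives `0 = 0`). [cite: Lichtman2020, §5.1] -/
theorem lamChiOn_factor_all {P Q P' Q' : ℝ}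
    (hdisj : ∀ p : ℕ, P ≤ p → (p : ℝ) ≤ Q → ¬ (P' ≤ p ∧ (p : ℝ) ≤ Q'))
    {q : ℕ} (χ : DirichletCharacter ℂ q) (m p : ℕ) (hp : p.Prime) (hP : P ≤ p) (hQ : (p : ℝ) ≤ Q) :
    lamChiOn (fun n => HasPrimeFactorIn P Q n ∧ HasPrimeFactorIn P' Q' n) χ (m * p) =
      lamChiOn (HasPrimeFactorIn P' Q') χ m * lamChi χ p := by
  rcases eq_or_ne m 0 with rfl | hm
  · have h0 : ¬ HasPrimeFactorIn P' Q' 0 := by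
      rintro ⟨r, hr, -, -⟩
      simp at hr
    unfold lamChiOn
    rw [zero_mul, if_neg (fun h => h0 h.2), if_neg h0, zero_mul]
  unfold lamChiOn
  have h1 : HasPrimeFactorIn P Q (m * p) := hasPrimeFactorIn_mul_of_prime hp hm hP hQ
  have h2 : HasPrimeFactorIn P' Q' (m * p) ↔ HasPrimeFactorIn P' Q' m :=
    hasPrimeFactorIn_mul_prime_iff hp hm (hdisj p hP hQ)
  by_cases hm' : HasPrimeFactorIn P' Q' m
  · rw [if_pos ⟨h1, h2.mpr hm'⟩, if_pos hm', lamChi_mul]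
  · rw [if_neg (fun h => hm' (h2.mp h.2)), if_neg hm', zero_mul]

/-- `‖z₁ + z₂ - z₃ + z₄‖² ≤ 4 (‖z₁‖² + ‖z₂‖² + ‖z₃‖² + ‖z₄‖²)`. [folklore] -/
theorem norm_sq_four_le (z₁ z₂ z₃ z₄ : ℂ) :
    ‖z₁ + z₂ - z₃ + z₄‖ ^ 2 ≤ 4 * (‖z₁‖ ^ 2 + ‖z₂‖ ^ 2 + ‖z₃‖ ^ 2 + ‖z₄‖ ^ 2) := by
  have h : ‖z₁ + z₂ - z₃ + z₄‖ ≤ ‖z₁‖ + ‖z₂‖ + ‖z₃‖ + ‖z₄‖ := by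
    calc ‖z₁ + z₂ - z₃ + z₄‖ ≤ ‖z₁ + z₂ - z₃‖ + ‖z₄‖ := norm_add_le _ _
      _ ≤ ‖z₁ + z₂‖ + ‖z₃‖ + ‖z₄‖ := by linarith [norm_sub_le (z₁ + z₂) z₃]
      _ ≤ ‖z₁‖ + ‖z₂‖ + ‖z₃‖ + ‖z₄‖ := by linarith [norm_add_le z₁ z₂]
  have h0 : 0 ≤ ‖z₁ + z₂ - z₃ + z₄‖ := norm_nonneg _
  calc ‖z₁ + z₂ - z₃ + z₄‖ ^ 2 ≤ (‖z₁‖ + ‖z₂‖ + ‖z₃‖ + ‖z₄‖) ^ 2 := pow_le_pow_left₀ h0 h 2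
    _ ≤ 4 * (‖z₁‖ ^ 2 + ‖z₂‖ ^ 2 + ‖z₃‖ ^ 2 + ‖z₄‖ ^ 2) := by
        nlinarith [sq_nonneg (‖z₁‖ - ‖z₂‖), sq_nonneg (‖z₁‖ - ‖z₃‖), sq_nonneg (‖z₁‖ - ‖z₄‖),
          sq_nonneg (‖z₂‖ - ‖z₃‖), sq_nonneg (‖z₂‖ - ‖z₄‖), sq_nonneg (‖z₃‖ - ‖z₄‖)]

/-- Integrating a pointwise four-term bound `|f|² ≤ 4 (|g₁|² + |g₂|² + |g₃|² + |g₄|²)` over `𝒯`. [folklore] -/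
theorem integral_four_le {T : ℝ} {𝒯 : Set ℝ} (h𝒯 : 𝒯 ⊆ Set.Icc (-T) T) (f g₁ g₂ g₃ g₄ : ℝ → ℂ)
    (h₁ : Continuous g₁) (h₂ : Continuous g₂) (h₃ : Continuous g₃) (h₄ : Continuous g₄)
    (hpt : ∀ t, ‖f t‖ ^ 2 ≤ 4 * (‖g₁ t‖ ^ 2 + ‖g₂ t‖ ^ 2 + ‖g₃ t‖ ^ 2 + ‖g₄ t‖ ^ 2)) :
    ∫ t in 𝒯, ‖f t‖ ^ 2 ≤ 4 * ((∫ t in 𝒯, ‖g₁ t‖ ^ 2) + (∫ t in 𝒯, ‖g₂ t‖ ^ 2) +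
      (∫ t in 𝒯, ‖g₃ t‖ ^ 2) + ∫ t in 𝒯, ‖g₄ t‖ ^ 2) := by
  have i₁ : Integrable (fun t => ‖g₁ t‖ ^ 2) (volume.restrict 𝒯) :=
    integrableOn_of_continuous (h₁.norm.pow 2) h𝒯
  have i₂ : Integrable (fun t => ‖g₂ t‖ ^ 2) (volume.restrict 𝒯) :=
    integrableOn_of_continuous (h₂.norm.pow 2) h𝒯
  have i₃ : Integrable (fun t => ‖g₃ t‖ ^ 2) (volume.restrict 𝒯) :=
    integrableOn_of_continuous (h₃.norm.pow 2) h𝒯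
  have i₄ : Integrable (fun t => ‖g₄ t‖ ^ 2) (volume.restrict 𝒯) :=
    integrableOn_of_continuous (h₄.norm.pow 2) h𝒯
  have i₁₂ : Integrable (fun t => ‖g₁ t‖ ^ 2 + ‖g₂ t‖ ^ 2) (volume.restrict 𝒯) := i₁.add i₂
  have i₁₂₃ : Integrable (fun t => ‖g₁ t‖ ^ 2 + ‖g₂ t‖ ^ 2 + ‖g₃ t‖ ^ 2) (volume.restrict 𝒯) :=
    i₁₂.add i₃
  have iall : Integrable (fun t => 4 * (‖g₁ t‖ ^ 2 + ‖g₂ t‖ ^ 2 + ‖g₃ t‖ ^ 2 + ‖g₄ t‖ ^ 2))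
      (volume.restrict 𝒯) := (i₁₂₃.add i₄).const_mul 4
  calc ∫ t in 𝒯, ‖f t‖ ^ 2 ≤ ∫ t in 𝒯, 4 * (‖g₁ t‖ ^ 2 + ‖g₂ t‖ ^ 2 + ‖g₃ t‖ ^ 2 + ‖g₄ t‖ ^ 2) :=
        integral_mono_of_nonneg (Filter.Eventually.of_forall fun t => by positivity) iall
          (Filter.Eventually.of_forall hpt)
    _ = _ := by rw [integral_const_mul, integral_add i₁₂₃ i₄, integral_add i₁₂ i₃, integral_add i₁ i₂]

/-- `e^{1/V} ≤ 7/4` for `V ≥ 2`, whence `N₂ e^{1/V} ≤ 14 N₁`. [folklore] -/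
theorem highN_mul_exp_le {Y V : ℝ} (hY : 2 ≤ Y) (hV : 2 ≤ V) :
    (highN Y : ℝ) * Real.exp (1 / V) ≤ 14 * lowN Y := by
  obtain ⟨-, hN₁lo, -, -, hN₂hi⟩ := range_facts hY
  have he : Real.exp (1 / V) ≤ 7 / 4 := by
    have h1 : Real.exp (1 / V) ≤ Real.exp (1 / 2) := Real.exp_le_exp.2 (by
      rw [div_le_div_iff₀ (by linarith) (by norm_num)]; linarith)
    have h2 : Real.exp (1 / 2 : ℝ) ≤ 7 / 4 := by
      have h3 : Real.exp (1 / 2 : ℝ) ^ 2 = Real.exp 1 := by rw [← Real.exp_nat_mul]; norm_num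
      nlinarith [Real.exp_one_lt_d9, Real.exp_pos (1 / 2 : ℝ)]
    linarith
  calc (highN Y : ℝ) * Real.exp (1 / V) ≤ (4 * Y) * (7 / 4) :=
        mul_le_mul hN₂hi he (Real.exp_pos _).le (by linarith)
    _ = 7 * Y := by ring
    _ ≤ 14 * lowN Y := by linarith

set_option maxHeartbeats 1600000 in
-- the assembly of the four pieces on the good set: one long bookkeeping proof
/-- **`E₁` repaired — the integral of `|G|²` over the good unit intervals.**  Let
`G(1+it) = ∑_{Y ≤ n ≤ 2Y, n ∈ S} λ(n)χ(n) n^{-1-it}`, `S = {HasPF[P₁,Q₁] ∧ HasPF[P₂,Q₂]}`,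
`1 ≤ P₁ ≤ Q₁ < P₂`, `V ≥ 2`, `0 < α < 1`, `Y ≥ 2`, smoothing parameters `λ > 0`, `0 < δ₀ ≤ 1/8`.  If every
shift `t - u`, `|u| ≤ 2λ`, of every point of the unit intervals `n ∈ G ⊆ [0, N_max]` is good (all
`‖Q_v(1+i(t-u))‖ ≤ e^{-αv/V}`, `v ∈ ℐ₁`), then with `T' = N_max + 1`, `T'' = N_max + 2 + 2λ`,
`m₀ = fejerMass`, `Λ₀ = e^{α/V} P₁^{-α} (1 + V/α)`:
`∑_{n ∈ G} ∫_n^{n+1} |G|² ≤ 4 [ (5T'+72Y)(4/Y²)(5Y(4/(m₀λδ₀))² + 8δ₀Y + 2) + (5T'+72Y)·32/(P₁Y)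
  + (5T'+144Y)·96(3/(m₀λ))²/Y + (6 log(1+2λ)/m₀)² Λ₀ · 15 · (10 e^{1/V}(1+V/(1-α)) Q₁^{1-α} T''/Y + 252 Λ₀) ]`
— the four terms being `G - G_γ`, `E_sq`, `D` (mean value theorem) and the smoothed main term
(`goodPart_mainPlus_le'`).  No factor `V²`: this is the repair of the printed bound for `E₁`.
[cite: Lichtman2020, §5.1, bound for E₁] -/
theorem goodPart_le {q : ℕ} (χ : DirichletCharacter ℂ q) {P₁ Q₁ P₂ Q₂ Y V α l δ₀ : ℝ}
    (hY : 2 ≤ Y) (hP₁ : 1 ≤ P₁) (hPQ₁ : P₁ ≤ Q₁) (hQP : Q₁ < P₂) (hV : 2 ≤ V) (hα : 0 < α) (hα1 : α < 1)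
    (hl : 0 < l) (hδ₀ : 0 < δ₀) (hδ₀' : δ₀ ≤ 1 / 8)
    (Nmax : ℕ) (G : Finset ℕ) (hG : ∀ n ∈ G, n ≤ Nmax)
    (hgood : ∀ n ∈ G, ∀ t ∈ Set.Icc (n : ℝ) (n + 1), ∀ u ∈ Set.Icc (-(2 * l)) (2 * l),
      ∀ v ∈ Icc ⌊V * Real.log P₁⌋₊ ⌊V * Real.log Q₁⌋₊,
        ‖blockPrimePoly (lamChi χ) P₁ Q₁ V v (t - u)‖ ≤ Real.exp (-(α * v / V))) :
    ∑ n ∈ G, ∫ t in (n : ℝ)..((n + 1 : ℕ) : ℝ),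
        ‖∑ n ∈ (Icc ⌈Y⌉₊ ⌊2 * Y⌋₊).filter (fun n => HasPrimeFactorIn P₁ Q₁ n ∧ HasPrimeFactorIn P₂ Q₂ n),
          ((ArithmeticFunction.liouville n : ℤ) : ℂ) * χ (n : ZMod q) * (n : ℂ) ^ (-(1 + (t : ℂ) * I))‖ ^ 2 ≤
      4 * ((5 * ((Nmax : ℝ) + 1) + 72 * Y) * (4 / Y ^ 2) * (5 * Y * (4 / (fejerMass * l * δ₀)) ^ 2 + 8 * δ₀ * Y + 2)
        + (5 * ((Nmax : ℝ) + 1) + 72 * Y) * (32 / (P₁ * Y))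
        + (5 * ((Nmax : ℝ) + 1) + 144 * Y) * (96 * (3 / (fejerMass * l)) ^ 2 / Y)
        + (6 * Real.log (1 + 2 * l) / fejerMass) ^ 2 * (Real.exp (α / V) * P₁ ^ (-α) * (1 + V / α)) *
          (15 * (10 * Real.exp (1 / V) * (1 + V / (1 - α)) * Q₁ ^ (1 - α) * ((Nmax : ℝ) + 2 + 2 * l) / Y
            + 252 * (Real.exp (α / V) * P₁ ^ (-α) * (1 + V / α))))) := by
  classical
  obtain ⟨hN₁1, hN₁lo, hN₁hi, hN₂lo, hN₂hi⟩ := range_facts hY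
  have hY0 : 0 < Y := by linarith
  have hV0 : 0 < V := by linarith
  obtain ⟨hbb, hblen⟩ := b_facts hY0 hδ₀.le hδ₀'
  have hm0 := fejerMass_pos
  set N₁ := lowN Y with hN₁def
  set N₂ := highN Y with hN₂def
  set b₁ := bLo Y δ₀ with hb₁
  set b₂ := bHi Y δ₀ with hb₂
  set S : ℕ → Prop := fun n => HasPrimeFactorIn P₁ Q₁ n ∧ HasPrimeFactorIn P₂ Q₂ n with hS
  set a : ℕ → ℂ := lamChiOn S χ with ha
  set b : ℕ → ℂ := lamChiOn (HasPrimeFactorIn P₂ Q₂) χ with hbdef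
  set c : ℕ → ℂ := lamChi χ with hcdef
  have ha1 : ∀ n, ‖a n‖ ≤ 1 := norm_lamChiOn_le _ χ
  have hb1 : ∀ m, ‖b m‖ ≤ 1 := norm_lamChiOn_le _ χ
  have hc1 : ∀ p, ‖c p‖ ≤ 1 := norm_lamChi_le χ
  have hγ : ∀ n, 0 ≤ gam l Y δ₀ n ∧ gam l Y δ₀ n ≤ 1 := gam_mem hl hY0 hδ₀.le hδ₀'
  -- the four pieces
  set Gf : ℝ → ℂ := fun t => ∑ n ∈ Icc ⌈Y⌉₊ ⌊2 * Y⌋₊, a n * cw[t, n] with hGf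
  set Df : ℝ → ℂ := fun t => ∑ n ∈ Icc N₁ N₂, (dCoeff l Y δ₀ n : ℂ) * a n * cw[t, n] with hDf
  set Mf : ℝ → ℂ := fun t => ∫ u in -(2 * l)..(2 * l),
    gammaFT (2 * l) b₁ b₂ u * sepPoly b c P₁ Q₁ N₁ N₂ V (t - u) with hMf
  set Ddf : ℝ → ℂ := fun t => ∑ p ∈ Pr[P₁, Q₁], ∑ m ∈ wideWindow N₁ N₂ V ⌊V * Real.log p⌋₊ \ pairSet N₁ N₂ p,
    (gam l Y δ₀ (p * m) : ℂ) * (c p * b m * wt[P₁, Q₁, m]) * cw[t, p * m] with hDdf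
  set Ef : ℝ → ℂ := fun t => ∑ p ∈ Pr[P₁, Q₁], ∑ m ∈ (pairSet N₁ N₂ p).filter (fun m => p ∣ m),
    (gam l Y δ₀ (p * m) : ℂ) * (c p * b m *
      (1 / (primeDivisorsIn P₁ Q₁ m : ℂ) - 1 / ((primeDivisorsIn P₁ Q₁ m : ℂ) + 1))) * cw[t, p * m] with hEf
  -- the identity `G = (G - G_γ) + Main⁺ - D + E_sq`
  have hdisj : ∀ p : ℕ, P₁ ≤ p → (p : ℝ) ≤ Q₁ → ¬ (P₂ ≤ p ∧ (p : ℝ) ≤ Q₂) :=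
    fun p _ h2 h => by linarith [h.1]
  have hfac : ∀ m p : ℕ, p.Prime → P₁ ≤ p → (p : ℝ) ≤ Q₁ → a (m * p) = b m * c p :=
    fun m p hp hP hQ => lamChiOn_factor_all hdisj χ m p hp hP hQ
  have hcop : ∀ n, (∀ p ∈ Pr[P₁, Q₁], ¬ p ∣ n) → a n = 0 :=
    fun n hn => lamChiOn_eq_zero_of_coprime (fun n h => h.1) χ hn
  have hident : ∀ t, Gf t = Df t + Mf t - Ddf t + Ef t := by
    intro t
    have h1 := diff_eq_sum_dCoeff hY0.le l δ₀ a t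
    have h2 := decomposition' hP₁ hPQ₁ hV0 hN₁1 (N₂ := N₂) a b c (gam l Y δ₀) hfac hcop t
    have h3 := mainPlus_eq_integral hl hbb hP₁ hPQ₁ hV0 hN₁1 (N₂ := N₂) b c t (b₁ := b₁) (b₂ := b₂)
    have h3' : ∑ p ∈ Pr[P₁, Q₁], ∑ m ∈ wideWindow N₁ N₂ V ⌊V * Real.log p⌋₊,
        (gam l Y δ₀ (p * m) : ℂ) * (c p * b m * wt[P₁, Q₁, m]) * cw[t, p * m] = Mf t := h3
    simp only [hGf, hDf, hDdf, hEf]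
    rw [← h3']
    linear_combination h1 + h2
  -- pointwise and integrated four-term bound over `𝒯 = unitUnion G`
  have hpt : ∀ t, ‖Gf t‖ ^ 2 ≤ 4 * (‖Df t‖ ^ 2 + ‖Mf t‖ ^ 2 + ‖Ddf t‖ ^ 2 + ‖Ef t‖ ^ 2) := by
    intro t; rw [hident t]; exact norm_sq_four_le _ _ _ _
  set T' : ℝ := (Nmax : ℝ) + 1 with hT'
  have hT'0 : 0 < T' := by positivity
  have hsubI : unitUnion G ⊆ Set.Icc (-T') T' := by
    intro t ht
    obtain ⟨n, hn, h1, h2⟩ := exists_mem_of_mem_unitUnion ht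
    have hn0 : (0 : ℝ) ≤ n := Nat.cast_nonneg n
    have hnN : (n : ℝ) ≤ Nmax := by exact_mod_cast hG n hn
    constructor <;> simp only [hT'] <;> linarith
  have hDc : Continuous Df := continuous_dsum _ _
  have hMc : Continuous Mf := continuous_mainPlus l b₁ b₂ b c P₁ Q₁ N₁ N₂ V
  have hDdc : Continuous Ddf := continuous_pairs _ _ _
  have hEc : Continuous Ef := continuous_pairs _ _ _
  have hint := integral_four_le hsubI Gf Df Mf Ddf Ef hDc hMc hDdc hEc hpt
  -- the left-hand side as a set integral
  have hGfc : Continuous fun t => ‖Gf t‖ ^ 2 := (continuous_dsum _ _).norm.pow 2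
  have hLHS : ∑ n ∈ G, ∫ t in (n : ℝ)..((n + 1 : ℕ) : ℝ),
      ‖∑ n ∈ (Icc ⌈Y⌉₊ ⌊2 * Y⌋₊).filter (fun n => HasPrimeFactorIn P₁ Q₁ n ∧ HasPrimeFactorIn P₂ Q₂ n),
        ((ArithmeticFunction.liouville n : ℤ) : ℂ) * χ (n : ZMod q) * (n : ℂ) ^ (-(1 + (t : ℂ) * I))‖ ^ 2 =
      ∫ t in unitUnion G, ‖Gf t‖ ^ 2 := by
    rw [setIntegral_unitUnion hGfc G]
    refine sum_congr rfl fun n _ => intervalIntegral.integral_congr fun t _ => ?_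
    simp only [hGf, ha, hS]
    rw [sum_filter_eq_sum_lamChiOn]
  rw [hLHS]
  refine hint.trans ?_
  have h4 : (0 : ℝ) ≤ 4 := by norm_num
  refine mul_le_mul_of_nonneg_left ?_ h4
  -- the four bounds
  have hB1 : ∫ t in unitUnion G, ‖Df t‖ ^ 2 ≤
      (5 * T' + 72 * Y) * (4 / Y ^ 2) * (5 * Y * (4 / (fejerMass * l * δ₀)) ^ 2 + 8 * δ₀ * Y + 2) :=
    meanvalue_diff_le ha1 hl hY hδ₀ hδ₀' hT'0 hsubI
  have hB2 : ∫ t in unitUnion G, ‖Ef t‖ ^ 2 ≤ (5 * T' + 72 * Y) * (32 / (P₁ * Y)) := by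
    have h := meanvalue_Esq_le hP₁ hN₁1 hb1 hc1 hγ hT'0 hsubI (Q := Q₁) (N₂ := N₂)
    refine h.trans ?_
    have hP0 : 0 < P₁ := by linarith
    have hN₁0 : (0 : ℝ) < N₁ := by exact_mod_cast hN₁1
    have h1 : (2 * (N₂ : ℝ) / P₁) / (N₁ : ℝ) ^ 2 ≤ 32 / (P₁ * Y) := by
      rw [div_div, div_le_div_iff₀ (by positivity) (by positivity)]
      have : Y ^ 2 / 4 ≤ (N₁ : ℝ) ^ 2 := by nlinarith
      calc 2 * (N₂ : ℝ) * (P₁ * Y) ≤ 2 * (4 * Y) * (P₁ * Y) := by gcongr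
        _ = 32 * (P₁ * (Y ^ 2 / 4)) := by ring
        _ ≤ 32 * (P₁ * (N₁ : ℝ) ^ 2) := by gcongr
    calc (5 * T' + 18 * (N₂ : ℝ)) * (2 * N₂ / P₁) / (N₁ : ℝ) ^ 2
        = (5 * T' + 18 * (N₂ : ℝ)) * ((2 * N₂ / P₁) / (N₁ : ℝ) ^ 2) := by ring
      _ ≤ (5 * T' + 72 * Y) * (32 / (P₁ * Y)) :=
          mul_le_mul (by linarith) h1 (by positivity) (by positivity)
  have hB3 : ∫ t in unitUnion G, ‖Ddf t‖ ^ 2 ≤ (5 * T' + 144 * Y) * (96 * (3 / (fejerMass * l)) ^ 2 / Y) :=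
    meanvalue_D_le hP₁ hPQ₁ hV hb1 hc1 hl hY hδ₀ hδ₀' hT'0 hsubI
  have hB4 : ∫ t in unitUnion G, ‖Mf t‖ ^ 2 ≤
      (6 * Real.log (1 + 2 * l) / fejerMass) ^ 2 * (Real.exp (α / V) * P₁ ^ (-α) * (1 + V / α)) *
        (15 * (10 * Real.exp (1 / V) * (1 + V / (1 - α)) * Q₁ ^ (1 - α) * ((Nmax : ℝ) + 2 + 2 * l) / Y
          + 252 * (Real.exp (α / V) * P₁ ^ (-α) * (1 + V / α)))) := by
    have hMc2 : Continuous fun t => ‖Mf t‖ ^ 2 := hMc.norm.pow 2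
    rw [setIntegral_unitUnion hMc2 G]
    have hk := highN_mul_exp_le hY hV
    have hT''0 : 0 < (Nmax : ℝ) + 2 + 2 * l := by positivity
    have hT'' : (Nmax : ℝ) + 1 + 2 * l ≤ (Nmax : ℝ) + 2 + 2 * l := by linarith
    have h := goodPart_mainPlus_le' hl hb1 c hP₁ hPQ₁ hN₁1 hV0 hk hα1 Nmax G hG hgood hT''0 hT''
      (b₁ := b₁) (b₂ := b₂)
    refine h.trans ?_
    -- monotonicity in `∫‖Γ‖ ≤ 6 log(1+2λ)/m₀` and `Λ ≤ Λ₀`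
    set IΓ := ∫ u in -(2 * l)..(2 * l), ‖gammaFT (2 * l) b₁ b₂ u‖ with hIΓ
    set Λ := ∑ v ∈ Icc ⌊V * Real.log P₁⌋₊ ⌊V * Real.log Q₁⌋₊, Real.exp (-(α * v / V)) with hΛ
    set Λ₀ := Real.exp (α / V) * P₁ ^ (-α) * (1 + V / α) with hΛ₀
    have hIΓ0 : 0 ≤ IΓ := intervalIntegral.integral_nonneg (by linarith) fun u _ => norm_nonneg _
    have hIΓle : IΓ ≤ 6 * Real.log (1 + 2 * l) / fejerMass :=
      integral_norm_gammaFT_le (by linarith) hbb hblen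
    have hΛ0' : 0 ≤ Λ := sum_nonneg fun v _ => (Real.exp_pos _).le
    have hΛle : Λ ≤ Λ₀ := blockSum_le hP₁ hV0 hα _
    have hQ1 : 1 ≤ Q₁ := hP₁.trans hPQ₁
    set A := 5 * Real.exp (1 / V) * (1 + V / (1 - α)) * Q₁ ^ (1 - α) * ((Nmax : ℝ) + 2 + 2 * l) with hA
    have hA0 : 0 ≤ A := by
      have : 0 < 1 - α := by linarith
      have : 0 ≤ Q₁ ^ (1 - α) := Real.rpow_nonneg (by linarith) _
      positivity
    have hN₁0 : (0 : ℝ) < N₁ := by exact_mod_cast hN₁1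
    have hAN : A / N₁ ≤ 2 * A / Y := by
      rw [div_le_div_iff₀ hN₁0 hY0]; nlinarith
    have hinner : ((14 : ℕ) + 1 : ℝ) * (A / N₁ + 18 * (14 : ℕ) * Λ) ≤ 15 * (2 * A / Y + 252 * Λ₀) := by
      push_cast
      nlinarith
    have hinner0 : 0 ≤ ((14 : ℕ) + 1 : ℝ) * (A / N₁ + 18 * (14 : ℕ) * Λ) := by positivity
    have e1 : ((14 : ℕ) + 1 : ℝ) * (5 * Real.exp (1 / V) * (1 + V / (1 - α)) * Q₁ ^ (1 - α) *
        ((Nmax : ℝ) + 2 + 2 * l) / N₁ + 18 * (14 : ℕ) * Λ) = ((14 : ℕ) + 1 : ℝ) * (A / N₁ + 18 * (14 : ℕ) * Λ) := by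
      rw [hA]
    rw [e1]
    have e2 : 15 * (10 * Real.exp (1 / V) * (1 + V / (1 - α)) * Q₁ ^ (1 - α) * ((Nmax : ℝ) + 2 + 2 * l) / Y
        + 252 * Λ₀) = 15 * (2 * A / Y + 252 * Λ₀) := by
      rw [hA]; ring
    rw [e2]
    exact mul_le_mul (mul_le_mul (pow_le_pow_left₀ hIΓ0 hIΓle 2) hΛle hΛ0' (by positivity))
      hinner hinner0 (by positivity)
  linarith [hB1, hB2, hB3, hB4]

end Literature.NumberTheory.Sieve.Lichtman2020.Smoothed
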